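/-
Copyright (c) 2026 the pub-hodgecm-mathlib formalisation cell (harness21).  Prover seat hodgecm-mathlib-K2Liu-p08 (g5): Track B «K2-LIT»,
#184♮ = hLiu418 = stmt-HodgeConjecture-24832; #42S organ S1, the (G) organ at a SPLIT place — the split twin of ★ (R-a)
`K2LiuLocalSWMiddleCellBruhat.offBigCell_cases` (LEAD F0P6-plan (g14) BATCH #44 «split twins = p08»).
-/
import Summits.HodgeConjecture.HodgeConjecture.Theorems.K2LiuLocalSWMiddleCellBruhat     -- ★ (R-a): `flip_mul_self_two`; ★ FILE 1 `exists_frame`; ★ F3c-A `mem_bigCell_iff_isUnit_det_blkC`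
import Literature.NumberTheory.GelbartRogawski1991.LocalDoubledUnitarySmoothSplit        -- ★ `splitEquivD`, `isSiegelDelta_of_blkC_matW_eq_zero`, `cayR_map`, `blkC_eq_adapt_toBlocks₂₁`
import Literature.NumberTheory.GelbartRogawski1991.LocalDoubledUnitaryUnramifiedSplit    -- ★ `matW_mul`
import Literature.NumberTheory.GelbartRogawski1991.LocalKudlaSplittingInjective          -- ★ `matW_eq_matA_map`
import Summits.HodgeConjecture.HodgeConjecture.Theorems.K2LiuSplitWitnessDuality           -- ★ p860775 `smul_ne_of_split` (both places above a split `v` are moved by `c`)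
import Mathlib.LinearAlgebra.Matrix.ToLinearEquiv                                        -- `Matrix.exists_mulVec_eq_zero_iff`
import HarnessLib

/-!
# Crux `HLiu418`, organ S1, row (R-a)-split: THE MIDDLE BRUHAT CELL OF `U(2,2)(F_v)` AT A SPLIT PLACE — off the big cell, `g ∈ P_Δ` or `g = p · w₁ · x`

Cell `hodgecm-mathlib`, crux item hLiu418 = `stmt-HodgeConjecture-24832`, route of record `HCCMUnconditional`; squad K2 ∕ K2Liu; LEAD F0P6-plan (g14).
THEOREMS ONLY (no `def`, no instance, no notation, no named-fact hypothesis, no `sorry`); lane `--supports stmt-HodgeConjecture-24832 --as helper` (count-neutral).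

THE MATHEMATICS ([Kudla1994, §3 Thm. 3.1]; [HarrisKudlaSweet1996, §1 (1.11), (1.15)]; [KudlaSweet1997, §1]).  ★ (R-a) `K2LiuLocalSWMiddleCellBruhat.offBigCell_cases`
(K2E5-p17) gives the cell decomposition off the big cell of the doubled unitary group `H(F_v)` for `n = 2` when `E ⊗ F_v` is a FIELD (non-split `v`).  At a SPLIT place
`E ⊗ F_v = E_w × E_{w̄}` is not a field, but `H(F_v) ≅ GL₄(E_w)` (★ `splitEquivD`: projection to the `w`-component) and `P_Δ` is read off ONE component (★
`isSiegelDelta_of_blkC_matW_eq_zero`); so the decomposition is the `GL₄` one, done in the adapted frame of the `w`-component `Ĝ = adapt (matW w g)` over the FIELD `E_w`: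
if `det C(g)` is not a unit of `E ⊗ F_v` then `det Ĝ₂₁ = 0` at SOME place `w` (§2); if `Ĝ₂₁ = 0` then `g ∈ P_Δ`; else (§1, linear algebra over `E_w`) there are
`a, b, d ∈ M₂(E_w)`, `a, d` invertible, with `Ĝ₂₁ a (1 − E_{ii}) + (Ĝ₂₁ b + Ĝ₂₂ d) E_{ii} = 0` (`a` a frame of `Ĝ₂₁` ★ `exists_frame`; `d` a completion of a vector `q ≠ 0` with
`Ĝ₂₂ q ∈ im Ĝ₂₁`), and the element `y ∈ H(F_v)` with `w`-component `R · [[a, b], [0, d]] · R⁻¹` (★ `splitEquivD.symm`) lies in `P_Δ` and satisfies `C(g·y·w₁)(w) = 0`, whence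
`g·y·w₁ ∈ P_Δ` and `g = (g y w₁) · w₁ · y⁻¹` (`w₁² = 1` ★ `flip_mul_self_two`).
* §1 `mul_single_eq_zero_iff`, `exists_invertible_col`, **`exists_core_split`** (the `2 × 2` linear algebra over a field);
* §2 `adapt_map`, `exists_place_det_blkC_eq_zero` (★ `K2LiuSplitWitnessDuality.smul_ne_of_split`: both places above a split `v` are moved by `c`);
* §3 **`offBigCell_cases_split`** — the `hcell` binder of ★ `K2LiuInertWitnessOffBigCell.offBigCell_add_mul_eq_zero_of_cells` at a split place.
HONEST LABEL: HC_CM is proved only modulo the 7 printed citations (2 remaining named inputs: hLiu418 = stmt-HodgeConjecture-24832, h413 = stmt-HodgeConjecture-24833) until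
rung 0 closes; count-neutral helper, closes no item.
References: [Kudla1994] S. Kudla, Israel J. Math. 87 (1994), §3; [HarrisKudlaSweet1996] J. AMS 9 (1996), §1; [KudlaSweet1997] S. Kudla, W. Sweet, Israel J. Math. 98 (1997), §1;
[GelbartRogawski1991] §3.1 p. 456 (`H(F_v) ≅ GL_{2n}` at a split place).
-/

set_option autoImplicit false
-- the mandated namespace repeats `HodgeConjecture.HodgeConjecture`
set_option linter.dupNamespace false

noncomputable section

namespace Summit.HodgeConjecture.HodgeConjecture.Cruxes.HLiu418.K2LiuSplitMiddleCellBruhat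

open NumberField IsDedekindDomain Matrix
open Literature.NumberTheory.Automorphic Literature.NumberTheory.Automorphic.UnitaryGroup
open Literature.NumberTheory.GelbartRogawski1991.AdaptedBlocks
open Literature.NumberTheory.GelbartRogawski1991.UnitaryDualPair.LocalSplitting
open Literature.NumberTheory.K2Lit.LocalSiegelDoubled
open Summit.HodgeConjecture.HodgeConjecture.Cruxes.HLiu418.K2LiuLocalSWBigCellDecomposition (mem_bigCell_iff_isUnit_det_blkC)
open Summit.HodgeConjecture.HodgeConjecture.Cruxes.HLiu418.K2LiuLocalSWMiddleCellFrame (exists_frame)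
open Summit.HodgeConjecture.HodgeConjecture.Cruxes.HLiu418.K2LiuLocalSWMiddleCellBruhat (flip_mul_self_two)

/-! ## §1 The `2 × 2` linear algebra over a field -/

section Core

variable {K : Type*} [Field K]

/-- `X · E_{ii} = 0` iff the `i`-th column of `X` vanishes. [cite: Kudla1994, §3] -/
theorem mul_single_eq_zero_iff (X : Matrix (Fin 2) (Fin 2) K) (i : Fin 2) :
    X * Matrix.single i i (1 : K) = 0 ↔ ∀ k, X k i = 0 := by
  constructor
  · intro h k
    have e := congrFun (congrFun h k) i
    rw [Matrix.mul_single_apply_same, mul_one] at e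
    exact e
  · intro h
    ext k l
    by_cases hl : l = i
    · subst hl; rw [Matrix.mul_single_apply_same, h k, zero_mul, Matrix.zero_apply]
    · rw [Matrix.mul_single_apply_of_ne (hbj := hl), Matrix.zero_apply]

/-- **column completion**: a non-zero vector of `K²` is the `i`-th column of an invertible matrix. [cite: Kudla1994, §3] -/
theorem exists_invertible_col (q : Fin 2 → K) (hq : q ≠ 0) (i : Fin 2) :
    ∃ d : Matrix (Fin 2) (Fin 2) K, IsUnit d.det ∧ ∀ k, d k i = q k := by
  have hq' : q 0 ≠ 0 ∨ q 1 ≠ 0 := by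
    by_contra h
    simp only [not_or, not_not] at h
    exact hq (funext fun k => by fin_cases k <;> simp [h.1, h.2])
  fin_cases i
  · rcases hq' with h0 | h1
    · refine ⟨!![q 0, 0; q 1, 1], ?_, fun k => by fin_cases k <;> rfl⟩
      rw [isUnit_iff_ne_zero, Matrix.det_fin_two_of]; simpa using h0
    · refine ⟨!![q 0, 1; q 1, 0], ?_, fun k => by fin_cases k <;> rfl⟩
      rw [isUnit_iff_ne_zero, Matrix.det_fin_two_of]; simpa using h1
  · rcases hq' with h0 | h1
    · refine ⟨!![0, q 0; 1, q 1], ?_, fun k => by fin_cases k <;> rfl⟩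
      rw [isUnit_iff_ne_zero, Matrix.det_fin_two_of]; simpa using h0
    · refine ⟨!![1, q 0; 0, q 1], ?_, fun k => by fin_cases k <;> rfl⟩
      rw [isUnit_iff_ne_zero, Matrix.det_fin_two_of]; simpa using h1

/-- **THE CORE**: for `C ≠ 0` singular and any `D`, there are `a, d` invertible and `b` with `C a (1 − E_{ii}) + (C b + D d) E_{ii} = 0` — the `2 × 2` algebra of the
middle cell at a split place (no unitarity needed: the second component of `P_Δ` is free).  `a` is a frame of `C` (★ `exists_frame`): `C a = r e_iᵀ`, `r ≠ 0`; if `det D = 0`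
take `b = 0` and `d ∋ q` a kernel vector of `D`; else `d ∋ q = D⁻¹ r` and `b = −a E_{ii}`. [cite: Kudla1994, §3 Thm. 3.1] [cite: KudlaSweet1997, §1] -/
theorem exists_core_split (C D : Matrix (Fin 2) (Fin 2) K) (hC : C ≠ 0) (hdet : C.det = 0) (i : Fin 2) :
    ∃ a b d : Matrix (Fin 2) (Fin 2) K, IsUnit a.det ∧ IsUnit d.det ∧
      C * a * (1 - Matrix.single i i 1) + (C * b + D * d) * Matrix.single i i 1 = 0 := by
  classical
  obtain ⟨a, hau, hframe⟩ := exists_frame (fun z hz => isUnit_iff_ne_zero.2 hz) C hC hdet i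
  -- the non-zero column `r` of `C a`
  have hr : (fun k => (C * a) k i) ≠ 0 := by
    intro hr0
    have h1 : C * a * Matrix.single i i (1 : K) = 0 := (mul_single_eq_zero_iff (C * a) i).2 fun k => congrFun hr0 k
    have h2 : C * a = 0 := by
      have e : C * a = C * a * Matrix.single i i (1 : K) + C * a * (1 - Matrix.single i i 1) := by rw [Matrix.mul_sub, Matrix.mul_one, add_sub_cancel]
      rw [e, h1, hframe, add_zero]
    apply hC
    calc C = C * a * a⁻¹ := by rw [Matrix.mul_nonsing_inv_cancel_right _ _ hau]
      _ = 0 := by rw [h2, Matrix.zero_mul]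
  by_cases hD : D.det = 0
  · -- `b = 0`, `d ∋ q ∈ ker D`
    obtain ⟨q, hq, hDq⟩ := Matrix.exists_mulVec_eq_zero_iff.2 hD
    obtain ⟨d, hdu, hdq⟩ := exists_invertible_col q hq i
    refine ⟨a, 0, d, hau, hdu, ?_⟩
    rw [hframe, zero_add, Matrix.mul_zero, zero_add]
    refine (mul_single_eq_zero_iff _ i).2 fun k => ?_
    have e : (D * d) k i = (D *ᵥ q) k := by
      simp only [Matrix.mul_apply, Matrix.mulVec, dotProduct, hdq]
    rw [e, hDq, Pi.zero_apply]
  · -- `q = D⁻¹ r`, `b = −a E_{ii}`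
    have hDu : IsUnit D.det := isUnit_iff_ne_zero.2 hD
    have hq : D⁻¹ *ᵥ (fun k => (C * a) k i) ≠ 0 := by
      intro h0
      apply hr
      have e : D *ᵥ (D⁻¹ *ᵥ fun k => (C * a) k i) = fun k => (C * a) k i := by
        rw [Matrix.mulVec_mulVec, Matrix.mul_nonsing_inv _ hDu, Matrix.one_mulVec]
      rw [← e, h0, Matrix.mulVec_zero]
    obtain ⟨d, hdu, hdq⟩ := exists_invertible_col _ hq i
    refine ⟨a, -(a * Matrix.single i i 1), d, hau, hdu, ?_⟩
    rw [hframe, zero_add]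
    refine (mul_single_eq_zero_iff _ i).2 fun k => ?_
    have e1 : (D * d) k i = (D *ᵥ (D⁻¹ *ᵥ fun k => (C * a) k i)) k := by
      simp only [Matrix.mul_apply, Matrix.mulVec, dotProduct, hdq]
    have e2 : D *ᵥ (D⁻¹ *ᵥ fun k => (C * a) k i) = fun k => (C * a) k i := by
      rw [Matrix.mulVec_mulVec, Matrix.mul_nonsing_inv _ hDu, Matrix.one_mulVec]
    rw [Matrix.add_apply, e1, e2, Matrix.mul_neg, Matrix.neg_apply, ← Matrix.mul_assoc, Matrix.mul_single_apply_same, mul_one, neg_add_cancel]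

end Core

/-! ## §2 Letters: `adapt` commutes with ring homs; a place where `det C(g)` vanishes -/

section Letters

/-- `adapt` commutes with ring homomorphisms (★ `cayR_map`, ★ `cayRinv_map`). [cite: HarrisKudlaSweet1996, §1 (1.11)] -/
theorem adapt_map {L L' : Type*} [CommRing L] [CommRing L'] [Invertible (2 : L)] [Invertible (2 : L')] {ι : Type*} [Fintype ι] [DecidableEq ι]
    (f : L →+* L') (M : Matrix (ι ⊕ ι) (ι ⊕ ι) L) : (adapt M).map f = adapt (M.map f) := by
  rw [adapt, adapt, Matrix.map_mul, Matrix.map_mul, cayR_map, cayRinv_map]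

variable (F : Type) [Field F] [NumberField F] (E : Type) [Field E] [NumberField E] [Algebra F E] [Algebra.IsQuadraticExtension F E]
  (c : E ≃ₐ[F] E) {δ : E} (hcδ : c δ = -δ) (hδ : δ ≠ 0) {d : F} (hd : δ * δ = algebraMap F E d)
  (v : HeightOneSpectrum (𝓞 F)) {T₀ : Matrix (Fin 2) (Fin 2) F} (hT₀ : T₀.IsSymm) (hT₀d : IsUnit T₀.det)
  {JD : Matrix (Fin (2 + 2)) (Fin (2 + 2)) E} (hJD : JD = (gramD F 2 T₀).map (algebraMap F E))

include hcδ hδ hd hT₀ hT₀d hJD in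
/-- **off the big cell, `det C(g)` vanishes at SOME place `w ∣ v`** (★ F3c-A: the big cell is `det C(g)` a unit of `E ⊗ F_v = Π_w E_w`; ★ `matW_eq_matA_map`).
[cite: Kudla1994, §3] [cite: Weil1964, n° 32] -/
theorem exists_place_det_blkC_eq_zero (g : UnitaryGroup.localPi E c (2 + 2) JD v)
    (hg : ¬ ∃ p, IsSiegelDelta F E c hcδ hδ hd v 2 hT₀ hJD p ∧ ∃ u ∈ unipDeltaLocal F E c v 2 (JD := JD), g = p * weylDelta F E c v 2 hJD * u) :
    ∃ w : PlacesOver E v, ((adapt (matW F E c v 2 w g)).toBlocks₂₁).det = 0 := by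
  rw [mem_bigCell_iff_isUnit_det_blkC F E c hcδ hδ hd v 2 hT₀ hT₀d hJD g, Pi.isUnit_iff, not_forall] at hg
  obtain ⟨w, hw⟩ := hg
  refine ⟨w, ?_⟩
  rw [isUnit_iff_ne_zero, not_not] at hw
  rw [matW_eq_matA_map, ← adapt_map]
  have e : ((adapt (matA F E c v 2 g)).map (Pi.evalRingHom (fun w' : PlacesOver E v => w'.1.adicCompletion E) w)).toBlocks₂₁ =
      ((adapt (matA F E c v 2 g)).toBlocks₂₁).map (Pi.evalRingHom (fun w' : PlacesOver E v => w'.1.adicCompletion E) w) := rfl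
  rw [e, ← RingHom.mapMatrix_apply, ← RingHom.map_det, ← blkC_eq_adapt_toBlocks₂₁]
  exact hw

end Letters

/-! ## §3 The cell decomposition off the big cell at a split place -/

section Split

variable (F : Type) [Field F] [NumberField F] (E : Type) [Field E] [NumberField E] [Algebra F E] [Algebra.IsQuadraticExtension F E]
  (c : E ≃ₐ[F] E) {δ : E} (hcδ : c δ = -δ) (hδ : δ ≠ 0) {d : F} (hd : δ * δ = algebraMap F E d)
  (v : HeightOneSpectrum (𝓞 F)) {T₀ : Matrix (Fin 2) (Fin 2) F} (hT₀ : T₀.IsSymm) (hT₀d : IsUnit T₀.det)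
  {JD : Matrix (Fin (2 + 2)) (Fin (2 + 2)) E} (hJD : JD = (gramD F 2 T₀).map (algebraMap F E))

include hT₀d in
/-- **THE CELL DECOMPOSITION OFF THE BIG CELL FOR `n = 2` AT A SPLIT PLACE** — the binder `hcell` of ★ `K2LiuInertWitnessOffBigCell.offBigCell_add_mul_eq_zero_of_cells`,
BY VALUE, at a place `v` SPLIT in `E` (`c • w₀ ≠ w₀`): for the flip `w₁` of the line `i` (adapted matrix `[[1 − E_{ii}, E_{ii}], [E_{ii}, 1 − E_{ii}]]`) and any `g ∈ H(F_v)` OFF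
the big cell `P_Δ w_Δ N_Δ`, either `g ∈ P_Δ`, or `g = p · w₁ · x` with `p, x ∈ P_Δ`.  The split twin of ★ (R-a) `offBigCell_cases`.
[cite: Kudla1994, §3 Thm. 3.1] [cite: HarrisKudlaSweet1996, §1 (1.11), (1.15)] [cite: KudlaSweet1997, §1] [cite: GelbartRogawski1991, §3.1 p. 456] -/
theorem offBigCell_cases_split (w₀ : PlacesOver E v) (hw₀ : c • w₀.1 ≠ w₀.1) (i : Fin 2) {w₁ : UnitaryGroup.localPi E c (2 + 2) JD v}
    (hw₁ : adapt (matA F E c v 2 w₁) =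
      Matrix.fromBlocks (1 - Matrix.single i i 1) (Matrix.single i i 1) (Matrix.single i i 1) (1 - Matrix.single i i 1))
    (g : UnitaryGroup.localPi E c (2 + 2) JD v)
    (hg : ¬ ∃ p, IsSiegelDelta F E c hcδ hδ hd v 2 hT₀ hJD p ∧ ∃ u ∈ unipDeltaLocal F E c v 2 (JD := JD), g = p * weylDelta F E c v 2 hJD * u) :
    IsSiegelDelta F E c hcδ hδ hd v 2 hT₀ hJD g ∨
      ∃ p x, IsSiegelDelta F E c hcδ hδ hd v 2 hT₀ hJD p ∧ IsSiegelDelta F E c hcδ hδ hd v 2 hT₀ hJD x ∧ g = p * w₁ * x := by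
  classical
  -- a place `w` where `det C(g)` vanishes; `w` is moved by `c`
  obtain ⟨w, hdet⟩ := exists_place_det_blkC_eq_zero F E c hcδ hδ hd v hT₀ hT₀d hJD g hg
  have hw : c • w.1 ≠ w.1 := K2LiuSplitWitnessDuality.smul_ne_of_split F E c v w₀ hw₀ w
  by_cases hC0 : (adapt (matW F E c v 2 w g)).toBlocks₂₁ = 0
  · left
    exact isSiegelDelta_of_blkC_matW_eq_zero F E c hcδ hδ hd v 2 hT₀ hT₀d hJD w hw (by rw [blkC_eq_adapt_toBlocks₂₁]; exact hC0)
  right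
  -- the `2 × 2` algebra at `w`
  obtain ⟨a, b, d', hau, hdu, hcore⟩ := exists_core_split _ (adapt (matW F E c v 2 w g)).toBlocks₂₂ hC0 hdet i
  -- the element `y ∈ H(F_v)` with `w`-component `R · [[a, b], [0, d′]] · R⁻¹`
  have hYdet : (Matrix.reindex (e₂ 2) (e₂ 2) (cayR (w.1.adicCompletion E) (Fin 2) * Matrix.fromBlocks a b 0 d' * cayRinv (w.1.adicCompletion E) (Fin 2))).det ≠ 0 := by
    rw [Matrix.det_reindex_self, Matrix.det_mul, Matrix.det_mul, mul_comm (cayR _ _).det, mul_assoc, ← Matrix.det_mul, cayR_mul_cayRinv,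
      Matrix.det_one, mul_one, Matrix.det_fromBlocks_zero₂₁]
    exact (hau.mul hdu).ne_zero
  set Y₁ : GL (Fin (2 + 2)) (w.1.adicCompletion E) :=
    ((Matrix.isUnit_iff_isUnit_det _).2 (isUnit_iff_ne_zero.2 hYdet)).unit with hY₁
  have hY₁c : (Y₁ : Matrix (Fin (2 + 2)) (Fin (2 + 2)) (w.1.adicCompletion E)) =
      Matrix.reindex (e₂ 2) (e₂ 2) (cayR (w.1.adicCompletion E) (Fin 2) * Matrix.fromBlocks a b 0 d' * cayRinv (w.1.adicCompletion E) (Fin 2)) := by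
    rw [hY₁, IsUnit.unit_spec]
  set y : UnitaryGroup.localPi E c (2 + 2) JD v := (splitEquivD F E c hcδ hδ v 2 hT₀ hT₀d hJD w hw).symm Y₁ with hy
  have hWy : adapt (matW F E c v 2 w y) = Matrix.fromBlocks a b 0 d' := by
    have h1 : matW F E c v 2 w y = Matrix.reindex (e₂ 2).symm (e₂ 2).symm (Y₁ : Matrix (Fin (2 + 2)) (Fin (2 + 2)) (w.1.adicCompletion E)) := by
      rw [hy, matW, splitEquivD_symm_apply_w]
    rw [h1, hY₁c, Matrix.reindex_apply, Matrix.reindex_apply, Matrix.submatrix_submatrix, Equiv.symm_symm, Equiv.symm_comp_self,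
      Matrix.submatrix_id_id, adapt_conj]
  have hyP : IsSiegelDelta F E c hcδ hδ hd v 2 hT₀ hJD y :=
    isSiegelDelta_of_blkC_matW_eq_zero F E c hcδ hδ hd v 2 hT₀ hT₀d hJD w hw (by rw [blkC_eq_adapt_toBlocks₂₁, hWy, Matrix.toBlocks_fromBlocks₂₁])
  -- the `w`-component of `w₁` in the adapted frame
  have hW₁ : adapt (matW F E c v 2 w w₁) = Matrix.fromBlocks (1 - Matrix.single i i 1) (Matrix.single i i 1) (Matrix.single i i 1) (1 - Matrix.single i i 1) := by
    rw [matW_eq_matA_map, ← adapt_map, hw₁, ← RingHom.mapMatrix_apply]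
    simp only [Matrix.fromBlocks_map, RingHom.mapMatrix_apply]
    rw [← RingHom.mapMatrix_apply, ← RingHom.mapMatrix_apply, map_sub, map_one, RingHom.mapMatrix_apply, Matrix.map_single, map_one]
  -- `C(g · y · w₁)(w) = 0`
  have hWg : adapt (matW F E c v 2 w g) = Matrix.fromBlocks (adapt (matW F E c v 2 w g)).toBlocks₁₁ (adapt (matW F E c v 2 w g)).toBlocks₁₂
      (adapt (matW F E c v 2 w g)).toBlocks₂₁ (adapt (matW F E c v 2 w g)).toBlocks₂₂ := (Matrix.fromBlocks_toBlocks _).symm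
  have hCh : blkC (matW F E c v 2 w (g * y * w₁)) = 0 := by
    rw [blkC_eq_adapt_toBlocks₂₁, matW_mul, matW_mul, adapt_mul, adapt_mul, hWy, hW₁, hWg, Matrix.fromBlocks_multiply, Matrix.fromBlocks_multiply,
      Matrix.toBlocks_fromBlocks₂₁]
    rw [Matrix.mul_zero, add_zero] at ⊢
    rw [← hcore, Matrix.add_mul]
  have hhP : IsSiegelDelta F E c hcδ hδ hd v 2 hT₀ hJD (g * y * w₁) := isSiegelDelta_of_blkC_matW_eq_zero F E c hcδ hδ hd v 2 hT₀ hT₀d hJD w hw hCh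
  -- `g = (g y w₁) · w₁ · y⁻¹`
  have hPP : Matrix.single i i (1 : LocalRing E v) * Matrix.single i i 1 = Matrix.single i i 1 := by
    rw [Matrix.single_mul_single_same, mul_one]
  have hw11 : w₁ * w₁ = 1 := flip_mul_self_two F E c v hPP hw₁
  refine ⟨g * y * w₁, y⁻¹, hhP, hyP.inv, ?_⟩
  rw [mul_assoc (g * y) w₁ w₁, hw11, mul_one, mul_inv_cancel_right]

end Split

end Summit.HodgeConjecture.HodgeConjecture.Cruxes.HLiu418.K2LiuSplitMiddleCellBruhat

end
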